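import Literature.AnabelianGeometry.EtaleTheta.Discharge.Sec5BiThetaIso
import Literature.AnabelianGeometry.EtaleTheta.Discharge.Sec5ConstantsKummer

/-!
# [EtTh] §5, Lemma 5.9 (iv) for the canonical Kummer part of `D` — proofs (p. 332 / PDF p. 106)

Mochizuki, *The étale theta function and its Frobenioid-theoretic manifestations*, Publ. RIMS **45**
(2009) [cite: MochizukiEtTh2009, Lem 5.9 (iv) p.106 (PRIMS p.332)].  Layer L2 of the abc-iut cell,
seat abc-iut-L2-t11 (wave-2 unit W2-L2-07).  PROOF-ONLY companion (no new definitions) closing the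
loop between `Discharge/Sec5BiThetaIso.lean` and `Discharge/Sec5ConstantsKummer.lean`.

abc-iut-L2-t4's `frdBiThetaEnv h1 h3 hsec hcs h8 DK` carries the `K^×`-part of `D ⊆ Out(E^Π_N)` that
is NOT generated by the constants `(O_K^×)^{1/N} ⊆ Aut_C(B_N)` (Lemma 5.8: the outer action "extends
to an outer action of `(K^×)^{1/N}/μ_N(B_N) ⥲ K^×`", which needs `Aut_{C^birat}(B_N^birat)`, not yet in
the tree) as a FREE parameter `DK` (this seat's finding F3).  Here we take for `DK` the CANONICAL
choice `DK₀ :=` the preimage of abc-iut-L2-t2's `kummerOut` (the `K^×`-part of `D_Y`, Def. 2.13 (i))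
under transport along `E^Π_N ≃ₜ* Π^tp_Y[μ_N]` — an EXTRINSIC choice (it uses the isomorphism of
(iv) itself), recorded honestly as such — and PROVE:
* `TopOut.transport_surjective` — transport of outer automorphisms along an isomorphism of
  topological groups is onto;
* `kummerOutReached_preimage` — for `DK₀` the hypothesis `KummerOutReached` holds outright;
* `constOutTransported_preimage` — for `DK₀` the hypothesis `ConstOutTransported` reduces to the
  inflation hypothesis of `Sec5ConstantsKummer.lean` alone;
* `envIsoBiTheta_canonical`, `frdIsMonoThetaEnv_canonical` — hence Lemma 5.9 (iv) (abc-iut-L2-t4's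
  `EnvIsoBiTheta`, `FrdIsMonoThetaEnv`) for `DK₀` MODULO only: `Facts`, the interface identifications
  (`ι`, `m`, `IdentifiesPiY/PiYdd`), the cyclotomic-character dictionary on `Π^tp_X̲`, the Prop. 5.2
  (iii) dictionary `ThetaSectionCompat`, and "the Kummer cocycle of every constant is inflated from
  `G_K`" (arithmetic).
HONEST FRAMING: [EtTh] is refereed; nothing of it is asserted unconditionally; typed ≠ proved;
discharged-modulo ≠ unconditional; the canonical `DK₀` is a choice made through the isomorphism, so
these corollaries do NOT assert that the intrinsically defined `K^×`-action of Lemma 5.8 generates the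
right subgroup — that is exactly the content isolated in `ConstOutTransported` / `KummerOutReached`;
no side is taken on any disputed claim downstream.
-/

namespace Literature.AnabelianGeometry.EtaleTheta

open CategoryTheory

universe w v v' u u'

/-- Transport of outer automorphisms along an isomorphism `e : A ≃ₜ* B` of topological groups
(abc-iut-L2-t2's `TopOut.transport`) is surjective: `φ ∈ Aut_top(B)` is the transport of
`e⁻¹ ∘ φ ∘ e ∈ Aut_top(A)`.  [cite: MochizukiEtTh2009, Def 2.13 (ii) p.47 (PRIMS p.273)] -/
theorem TopOut.transport_surjective {A B : Type*} [Group A] [Group B] [TopologicalSpace A]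
    [TopologicalSpace B] (e : A ≃ₜ* B) : Function.Surjective (TopOut.transport e) := by
  intro y
  induction y using QuotientGroup.induction_on with
  | H φ =>
    refine ⟨TopOut.mk _ ⟨MulAut.congr e.symm.toMulEquiv φ.1, conjAut_mem_contMulAut e.symm φ.2⟩,
      ?_⟩
    change TopOut.mk _ (conjContAut e _) = TopOut.mk _ φ
    congr 1
    apply Subtype.ext
    apply MulEquiv.ext
    intro b
    change e (e.symm (φ.1 (e (e.symm b)))) = φ.1 b
    rw [e.apply_symm_apply, e.apply_symm_apply]

namespace ThetaFrobenioid

variable {C : Type u} [Category.{v} C] {D : Type u'} [Category.{v'} D]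
  (𝔉 : ThetaFrobenioid.{w} C D)

section Canonical

variable (H : 𝔉.Facts) (h1 : 𝔉.SectionsFactor) (h3 : 𝔉.OuterActionLZ) (hsec : 𝔉.SgpCapSection)
  (hcs : 𝔉.SgpCupSection) (h8 : 𝔉.ConstantsEqNormalizer)
  (T : ThetaEnvData.{v} 𝔉.N) (ι : 𝔉.PiX ≃ₜ* T.PiX) (m : 𝔉.muTorsion 𝔉.BN 𝔉.N ≃* T.mu)
  (hY : 𝔉.IdentifiesPiY T ι.toMulEquiv) (hYdd : 𝔉.IdentifiesPiYdd T ι.toMulEquiv)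
  (hχX : 𝔉.CyclotomicCharacterCompatX T ι.toMulEquiv m)

/-- **`KummerOutReached` holds outright for the canonical residual datum** `DK₀ :=` the transport-
preimage of `kummerOut`.  Arguments: `H h1 h3 hsec hcs h8 T ι m hY hχX`.
[cite: MochizukiEtTh2009, Lem 5.9 (iv) p.106 (PRIMS p.332)] -/
theorem kummerOutReached_preimage :
    𝔉.KummerOutReached H h1 h3 hsec hcs h8
      (TopOut.transport (𝔉.envContIso H T ι m hY hχX.toY) ⁻¹' T.kummerOut) T ι m hY hχX.toY := by
  intro x hx
  obtain ⟨y, rfl⟩ := TopOut.transport_surjective (𝔉.envContIso H T ι m hY hχX.toY) x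
  exact Subgroup.mem_map_of_mem _
    (Subgroup.subset_closure (Or.inr hx) :
      y ∈ (𝔉.frdBiThetaEnv h1 h3 hsec hcs h8
        (TopOut.transport (𝔉.envContIso H T ι m hY hχX.toY) ⁻¹' T.kummerOut)).D)

/-- **`ConstOutTransported` for the canonical residual datum REDUCES to the inflation hypothesis**
("the Kummer cocycle of every constant `u ∈ (O_K^×)^{1/N}` is inflated from `G_K`", Lemma 5.8;
`Sec5ConstantsKummer.lean`).  Arguments: `H h8 T ι m hY hχX hinflAll`.
[cite: MochizukiEtTh2009, Lem 5.9 (iv) p.106 (PRIMS p.332)] -/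
theorem constOutTransported_preimage
    (hinflAll : ∀ u ∈ 𝔉.OKxRootN, ∃ δ₀ : T.G → T.mu, ∀ (y : 𝔉.PiX) (hy : y ∈ 𝔉.PiY)
      (hc : u * 𝔉.sgpCap (𝔉.ρ y) * u⁻¹ * (𝔉.sgpCap (𝔉.ρ y))⁻¹ ∈ 𝔉.muTorsion 𝔉.BN 𝔉.N),
      m ⟨_, hc⟩ = δ₀ (T.aug (ι y))) :
    𝔉.ConstOutTransported H h8
      (TopOut.transport (𝔉.envContIso H T ι m hY hχX.toY) ⁻¹' T.kummerOut) T ι m hY hχX.toY :=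
  𝔉.constOutTransported_of H T ι m hY hχX.toY h8 _ hinflAll (by
    rintro _ ⟨y, hy, rfl⟩
    exact Subgroup.subset_closure (Or.inl hy))

/-- **[EtTh] Lemma 5.9 (iv) for the canonical Kummer part** — abc-iut-L2-t4's `EnvIsoBiTheta` with
`DK := DK₀` DISCHARGED MODULO: `Facts`, the identifications `ι` (continuous, carrying `Π^tp_Y̲, Π^tp_Ÿ̲`
onto `Π^tp_Y, Π^tp_Ÿ`) and `m`, the cyclotomic-character dictionary on `Π^tp_X̲`, the Prop. 5.2 (iii)
dictionary for a cocycle `η` of the collection, and the inflation of the constants' Kummer cocycles.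
[cite: MochizukiEtTh2009, Lem 5.9 (iv) p.106 (PRIMS p.332)] -/
theorem envIsoBiTheta_canonical {η : T.PiYdd → T.mu} (hη : η ∈ T.thetaCocycles)
    (hcompat : 𝔉.ThetaSectionCompat H T ι.toMulEquiv m hYdd η)
    (hinflAll : ∀ u ∈ 𝔉.OKxRootN, ∃ δ₀ : T.G → T.mu, ∀ (y : 𝔉.PiX) (hy : y ∈ 𝔉.PiY)
      (hc : u * 𝔉.sgpCap (𝔉.ρ y) * u⁻¹ * (𝔉.sgpCap (𝔉.ρ y))⁻¹ ∈ 𝔉.muTorsion 𝔉.BN 𝔉.N),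
      m ⟨_, hc⟩ = δ₀ (T.aug (ι y))) :
    𝔉.EnvIsoBiTheta h1 h3 hsec hcs h8
      (TopOut.transport (𝔉.envContIso H T ι m hY hχX.toY) ⁻¹' T.kummerOut) T ι :=
  𝔉.envIsoBiTheta_of H h1 h3 hsec hcs h8 _ T ι m hY hYdd hχX hη hcompat
    (𝔉.constOutTransported_preimage H h8 T ι m hY hχX hinflAll)
    (𝔉.kummerOutReached_preimage H h1 h3 hsec hcs h8 T ι m hY hχX)

/-- **Lemma 5.9 (iv) "In particular" for the canonical Kummer part**: abc-iut-L2-t4's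
`FrdIsMonoThetaEnv` with `DK := DK₀`, modulo the same hypotheses.
[cite: MochizukiEtTh2009, Lem 5.9 (iv) p.106 (PRIMS p.332)] -/
theorem frdIsMonoThetaEnv_canonical {η : T.PiYdd → T.mu} (hη : η ∈ T.thetaCocycles)
    (hcompat : 𝔉.ThetaSectionCompat H T ι.toMulEquiv m hYdd η)
    (hinflAll : ∀ u ∈ 𝔉.OKxRootN, ∃ δ₀ : T.G → T.mu, ∀ (y : 𝔉.PiX) (hy : y ∈ 𝔉.PiY)
      (hc : u * 𝔉.sgpCap (𝔉.ρ y) * u⁻¹ * (𝔉.sgpCap (𝔉.ρ y))⁻¹ ∈ 𝔉.muTorsion 𝔉.BN 𝔉.N),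
      m ⟨_, hc⟩ = δ₀ (T.aug (ι y))) :
    𝔉.FrdIsMonoThetaEnv h1 h3 hsec hcs h8
      (TopOut.transport (𝔉.envContIso H T ι m hY hχX.toY) ⁻¹' T.kummerOut) T :=
  𝔉.frdIsMonoThetaEnv_of h1 h3 hsec hcs h8 _ T ι
    (𝔉.envIsoBiTheta_canonical H h1 h3 hsec hcs h8 T ι m hY hYdd hχX hη hcompat hinflAll)

end Canonical

end ThetaFrobenioid

end Literature.AnabelianGeometry.EtaleTheta
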